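import Literature.AlgebraicGeometry.ModuliOfAbelianVarieties.SiegelFamilyHumbertLocusOrbit
import Literature.AlgebraicGeometry.ModuliOfAbelianVarieties.SiegelFamilyHumbertEndomorphism
import HarnessLib

/-!
# Runge's Theorem 2: the `Sp₄(ℤ)`-conjugacy classes of the Rosati-invariant integer matrices `n·1 + R₀(q)` are classified
# by trace, content and invariant

Layer `Literature/AlgebraicGeometry/ModuliOfAbelianVarieties`, namespace
`Literature.AlgebraicGeometry.ModuliOfAbelianVarieties.SiegelModuli`; lane `lit-hodgefound` (Track 2 foundations library,
Layer A4), seat `lit-hodgefound-skel-4`, row **A4-65**, FILE 3 — Runge's own formulation of Humbert's lemma, on top of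
FILE 1 (`SiegelFamilyHumbertLemma`: `HumbertEquiv`, `IsPrimitiveRel`, `spInv`, `humbertVectorConj_mul`,
`eq_humbertGram_add_smul_typeForm`, `IsPrimitiveRel.humbertEquiv_iff/_smul/_neg`, `exists_humbertEquiv_humbertNormalForm`),
FILE 2 (`SiegelFamilyHumbertLocusOrbit`: `humbertLocusPrim Δ = N_Δ`, `humbertLocusOfInvariant_eq_iUnion_humbertLocusPrim`,
`mem_humbertLocusPrim_iff_exists_smul_modularEmbedding`), row A4-59′ (`SiegelFamilyHumbertEndomorphism`: B–W's rational
representation `humbertRatRep q = R₀` of the symmetric endomorphism `f₀` of a relation, `typeForm_mul_humbertRatRep : E₁ R₀ = N(q)`,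
`neg_typeForm_mul_humbertGram : −E₁ N(q) = R₀`), row A4-62 (`exists_eq_smul_primitive`: every `q ≠ 0` is `m · q₀` with `q₀`
primitive) and rows A4-56/A4-59″ (`hodgeExceptionalLocus 2 = 𝒩(𝔥₂)`, `hodgeExceptionalLocus_two_eq_iUnion_humbertLocusOfInvariant`)
— BY NAME.

## Source (verbatim)

B. Runge, *Endomorphism rings of abelian surfaces and projective models of their moduli spaces*, Tohoku Math. J. **51**
(1999), §4, p. 288: "A Rosati invariant matrix is of type `M = (A B; C ᵗA)` [with `B`, `C` integer multiples of `(0 1; −1 0)`]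
and the above equation is equivalent to […] which is the type of equations studied by Humbert in the last century [Hu].
Humbert called such a relation a singular relation. Any Rosati invariant matrix `M` satisfies
`M² − Tr(A)M + det(A) + bc = 0`, and hence has the reduced Trace `t(M) = Tr(A)` and the discriminant
`Δ(M) = Tr(A)² − 4(det(A) + bc)` […]. We call `M` primitive if `ℤ[M] = ℚ(M) ∩ M₄(ℤ)` and normalized if `Tr(A) ∈ {0, 1}`.
[…] THEOREM 2. Let `M₁`, `M₂` be Rosati invariant elements in `M₄(ℤ)`. Then there exists an element `σ ∈ Γ₂` such that
`σM₁σ⁻¹ = M₂` if and only if `t(M₁) = t(M₂)`, `g.c.d(M₁) = g.c.d(M₂)` and `Δ(M₁) = Δ(M₂)`. PROOF. Conjugation preserves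
the minimal equation, and hence preserves `t(M)` and `Δ(M)`. So let assume `t(M₁) = t(M₂)` and `Δ(M₁) = Δ(M₂)`. Moreover,
we may assume that both matrices are primitive and normalized." — and p. 290: "Therefore we finally obtain a normal form
for primitive normalized matrices … `Δ(M) = 4k + l` with `k ∈ ℤ` and `l ∈ {0, 1}`."
Ch. Birkenhake, H. Wilhelm, Trans. AMS **355** (2003), §4 (7) (p. 1827): "`ρ_{r,M(Z)} = ᵗM⁻¹ρ_{r,Z}ᵗM`", Lemma 4.1 / (9)
(the rational representation `R₀` of `f₀`).

## Dictionary

In the tree's letters `q = (a, b, c, d, e)`, Runge's Rosati-invariant matrices are exactly the `X(n, q) := n·1₄ + R₀(q)`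
(`rosatiMatrix n q`; `A = (n a; −c n+b)`), `2·t(M) = tr X(n, q) = 4n + 2b` (`trace_rosatiMatrix`), `Δ(M) = Δ(q)`, and
`g.c.d(M)` = the content `relContent q` of the relation part (the scalar part `n` being recorded by `t`); `Γ₂ = Sp₄(ℤ)` acts
by `X ↦ σXσ⁻¹`, `σ = M⁻¹ = spInv M` for an integral symplectic `M` (`ᵗM E₁ M = E₁`).

## Contents (definitions with bodies and PROVED theorems; NO named fact, net debt 0)

* §1 **`relContent q = g.c.d.(a, b, c, d, e)`** (Mathlib `Finset.gcd`): `relContent_eq_zero_iff`, `normalize_relContent`,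
  `relContent_dvd`, `relContent_smul` (`content(mq) = |m|·content(q)`), `isPrimitiveRel_iff_relContent_eq_one`,
  **`HumbertEquiv.relContent_eq`** (the content is an `Sp₄(ℤ)`-invariant),
  **`humbertEquiv_iff_relContent_eq_and_humbertInvariant_eq : q ∼ q′ ⟺ content(q) = content(q′) ∧ Δ(q) = Δ(q′)`** (Theorem 2
  on relation vectors; from FILE 1's primitive case), `exists_relContent_eq_and_humbertInvariant_eq_iff` (a class with
  content `m` and invariant `Δ` exists iff `m² ∣ Δ` and `Δ/m² ≡ 0, 1 mod 4`).
* §2 **`rosatiMatrix n q = X(n, q)`**, `rosatiMatrix_eq_smul_one_add`, `trace_rosatiMatrix`, `rosatiMatrix_injective`,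
  `humbertRatRep_add`, **`spInv_mul_humbertRatRep_mul : (−E₁ᵗME₁) R₀(q) M = R₀(q^M) + t·1`** (`t = (ᵗM N(q) M)_{x₁y₁}`; B–W (7):
  transport of relations is conjugation of `R₀` up to the scalar of the lost `E₁`-component; valid for EVERY integer `M`),
  **`spInv_mul_rosatiMatrix_mul : M⁻¹ X(n, q) M = X(n + t, q^M)`** for `M ∈ Sp₄(ℤ)`.
* §3 **`exists_conj_rosatiMatrix_iff`** (`X(n,q)`, `X(n′,q′)` are `Sp₄(ℤ)`-conjugate iff equal traces and `q ∼ q′`),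
  **`runge_theorem_two`** (… iff equal traces, equal contents, equal invariants — THEOREM 2 as printed), and
  `exists_conj_rosatiMatrix_humbertNormalForm` (Runge's normal form: `X(n, q)` with `q` primitive is conjugate to some
  `X(n′, (k, l, −1, 0, 0))`, `l ∈ {0, 1}`).
* §4 HUMBERT'S SINGULAR ABELIAN SURFACES: `hodgeExceptionalLocus_two_eq_iUnion_humbertLocusPrim` (`𝒩(𝔥₂) = ⋃_Δ N_Δ`) and
  **`mem_hodgeExceptionalLocus_two_iff_exists_smul_modularEmbedding`**: `ρ(X_Z) ≥ 2` (a Hodge class off `ℚθ_Z`) iff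
  `Z = γ · π_{k,l}(τ)` for some `γ ∈ Sp₄(ℤ)`, `l² + 4k > 0`, `τ ∈ ℍ × ℍ` — every such surface is `Sp₄(ℤ)`-equivalent to a
  member of one of Runge's standard models.

## Scope

* "Rosati invariant elements in `M₄(ℤ)`" are taken in Runge's normalised shape `(A B; C ᵗA)`, `B, C ∈ ℤ·(0 1; −1 0)`, i.e. the
  matrices `X(n, q)`; that these are exactly the rational representations of the symmetric endomorphisms of the
  principally polarised `X_Z` (for `Z` on the locus of `q`) is rows A4-59′/A4-59‴ (B–W Lemma 4.1, Cor. 4.2), not restated.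
* Runge's "primitive" (`ℤ[M] = ℚ(M) ∩ M₄(ℤ)`) is rendered by the content of the relation part (`relContent q = 1`), which is
  what his proof uses ("we may assume that both matrices are primitive and normalized"); the order-theoretic phrasing and
  Corollary 3 (isomorphism of the orders `ℚ(M) ∩ M₄(ℤ)`) are not formalised.

## References

* [Runge1999EndomorphismRingsAbelianSurfaces] B. Runge, Tohoku Math. J. 51 (1999) 283–303, §4 p. 288 (Thm. 2), p. 290.
* [BirkenhakeWilhelm2003] Ch. Birkenhake, H. Wilhelm, Trans. AMS 355 (2003) 1819–1841, §4 (7), Lemma 4.1, (9) (p. 1827).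
* [GuoYang2019] J.-W. Guo, Y. Yang, arXiv:1903.07225, §2 ("primitive if `gcd(a,b,c,d,e) = 1`").
* [HashimotoMurabayashi1995] K. Hashimoto, N. Murabayashi, Tohoku Math. J. 47 (1995), Def. 3.6.
-/
noncomputable section

open Matrix Complex Module Function Set
open scoped UpperHalfPlane

namespace Literature.AlgebraicGeometry.ModuliOfAbelianVarieties

namespace SiegelModuli

open Literature.NumberTheory.Automorphic (siegelUpperHalfSpace)
open Literature.NumberTheory.ModularForms.SiegelUpperHalfSpace
open Literature.Geometry.Kaehler Literature.Geometry.Kaehler.ComplexTorus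
open Literature.Analysis.Complex Literature.LinearAlgebra.Alternating
open Sum

/-! ## §1 The content of a relation vector; `Sp₄(ℤ)`-classes of relation vectors = (content, invariant) -/

section Content

variable {q q' : Fin 5 → ℤ}

/-- **The content `g.c.d.(a, b, c, d, e) ≥ 0` of an integer relation vector** (Runge's "`g.c.d(M)`"; a relation is
primitive iff its content is `1`). [cite: Runge1999EndomorphismRingsAbelianSurfaces, §4 Thm. 2 (p. 288)] [cite: GuoYang2019, §2 ("primitive if `gcd(a,b,c,d,e) = 1`")] -/
def relContent (q : Fin 5 → ℤ) : ℤ := Finset.univ.gcd q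

/-- `content(q) = 0 ⟺ q = 0`. [cite: Runge1999EndomorphismRingsAbelianSurfaces, §4 Thm. 2 (p. 288)] -/
theorem relContent_eq_zero_iff (q : Fin 5 → ℤ) : relContent q = 0 ↔ q = 0 := by
  rw [relContent, Finset.gcd_eq_zero_iff]
  constructor
  · intro h
    funext i
    exact h i (Finset.mem_univ i)
  · rintro rfl i -
    rfl

/-- The content is normalised (non-negative). [cite: Runge1999EndomorphismRingsAbelianSurfaces, §4 Thm. 2 (p. 288)] -/
theorem normalize_relContent (q : Fin 5 → ℤ) : normalize (relContent q) = relContent q :=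
  Finset.normalize_gcd

/-- The content divides every entry. [cite: Runge1999EndomorphismRingsAbelianSurfaces, §4 Thm. 2 (p. 288)] -/
theorem relContent_dvd (q : Fin 5 → ℤ) (i : Fin 5) : relContent q ∣ q i :=
  Finset.gcd_dvd (Finset.mem_univ i)

/-- **A primitive relation has content `1`.** [cite: GuoYang2019, §2] -/
theorem IsPrimitiveRel.relContent_eq_one (hq : IsPrimitiveRel q) : relContent q = 1 := by
  rcases hq.eq_one_or_eq_neg_one_of_dvd (relContent_dvd q) with h | h
  · exact h
  · exfalso
    have hn := normalize_relContent q
    rw [h, ← Int.abs_eq_normalize] at hn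
    norm_num at hn

/-- `content(m q) = |m| · content(q)`. [cite: Runge1999EndomorphismRingsAbelianSurfaces, §4 Thm. 2 (p. 288)] -/
theorem relContent_smul (m : ℤ) (q : Fin 5 → ℤ) : relContent (m • q) = |m| * relContent q := by
  rw [relContent, relContent, Int.abs_eq_normalize, ← Finset.gcd_mul_left]
  rfl

/-- **Conversely, content `1` means primitive.** [cite: GuoYang2019, §2] -/
theorem isPrimitiveRel_of_relContent_eq_one (h : relContent q = 1) : IsPrimitiveRel q := by
  intro m q'' hq''
  have hc := relContent_smul m q''
  rw [← hq'', h] at hc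
  exact (abs_eq zero_le_one).1 (Int.eq_one_of_mul_eq_one_right (abs_nonneg m) hc.symm)

/-- `q` primitive `⟺ content(q) = 1`. [cite: GuoYang2019, §2] -/
theorem isPrimitiveRel_iff_relContent_eq_one (q : Fin 5 → ℤ) : IsPrimitiveRel q ↔ relContent q = 1 :=
  ⟨IsPrimitiveRel.relContent_eq_one, isPrimitiveRel_of_relContent_eq_one⟩

/-- **The content is an invariant of `Sp₄(ℤ)`-equivalence** (`(m q₀)^M = m q₀^M` with `q₀^M` primitive).
[cite: Runge1999EndomorphismRingsAbelianSurfaces, §4 Thm. 2 (p. 288)] -/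
theorem HumbertEquiv.relContent_eq (h : HumbertEquiv q q') : relContent q' = relContent q := by
  by_cases hq : q = 0
  · subst hq
    obtain ⟨M, -, rfl⟩ := h
    have h0 : humbertVectorConj M 0 = 0 := by simpa using humbertVectorConj_smul M 0 0
    rw [h0]
  obtain ⟨m, q₀, hm, rfl, hprim⟩ := exists_eq_smul_primitive hq
  obtain ⟨M, hM, rfl⟩ := h
  rw [humbertVectorConj_smul, relContent_smul, relContent_smul, IsPrimitiveRel.relContent_eq_one hprim,
    IsPrimitiveRel.relContent_eq_one (IsPrimitiveRel.of_humbertEquiv hprim ⟨M, hM, rfl⟩)]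

/-- **RUNGE'S THEOREM 2 on relation vectors: two integer singular relations are `Sp₄(ℤ)`-equivalent iff they have the same
content and the same invariant** ("there exists an element `σ ∈ Γ₂` such that `σM₁σ⁻¹ = M₂` if and only if `t(M₁) = t(M₂)`,
`g.c.d(M₁) = g.c.d(M₂)` and `Δ(M₁) = Δ(M₂)`" — the reduced trace `t`, i.e. the `E₁`-component, is not part of a relation
vector). [cite: Runge1999EndomorphismRingsAbelianSurfaces, §4 Thm. 2 (p. 288)] -/
theorem humbertEquiv_iff_relContent_eq_and_humbertInvariant_eq (q q' : Fin 5 → ℤ) :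
    HumbertEquiv q q' ↔ relContent q = relContent q' ∧ humbertInvariant q = humbertInvariant q' := by
  refine ⟨fun h ↦ ⟨h.relContent_eq.symm, h.humbertInvariant_eq.symm⟩, fun ⟨hc, hΔ⟩ ↦ ?_⟩
  by_cases hq : q = 0
  · subst hq
    have hq' : q' = 0 := (relContent_eq_zero_iff q').1 (by rw [← hc]; exact (relContent_eq_zero_iff 0).2 rfl)
    subst hq'
    exact HumbertEquiv.refl 0
  have hq' : q' ≠ 0 := fun h0 ↦ hq ((relContent_eq_zero_iff q).1 (by rw [hc, h0]; exact (relContent_eq_zero_iff 0).2 rfl))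
  obtain ⟨m, q₀, hm, rfl, hprim⟩ := exists_eq_smul_primitive hq
  obtain ⟨m', q₀', hm', rfl, hprim'⟩ := exists_eq_smul_primitive hq'
  rw [relContent_smul, relContent_smul, IsPrimitiveRel.relContent_eq_one hprim, IsPrimitiveRel.relContent_eq_one hprim',
    mul_one, mul_one] at hc
  rw [humbertInvariant_smul, humbertInvariant_smul, ← sq_abs m, ← sq_abs m', hc] at hΔ
  have hΔ₀ : humbertInvariant q₀ = humbertInvariant q₀' :=
    mul_left_cancel₀ (pow_ne_zero 2 (abs_ne_zero.2 hm')) hΔ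
  obtain ⟨h₁, h₂⟩ := IsPrimitiveRel.humbertEquiv_smul hprim hprim' hΔ₀ m
  rcases abs_eq_abs.1 hc with h | h
  · rw [← h]; exact h₁
  · rw [show m' = -m by omega]; exact h₂

/-- **Existence: a relation of content `m > 0` and invariant `Δ` exists iff `m² ∣ Δ` and `Δ/m² ≡ 0, 1 mod 4`** (take
`m · (⌊Δ′/4⌋, Δ′ mod 4, −1, 0, 0)`, `Δ′ = Δ/m²`); with the classification this counts the `Sp₄(ℤ)`-classes of relations of
invariant `Δ`. [cite: Runge1999EndomorphismRingsAbelianSurfaces, §4 Thm. 2 (p. 288) and p. 290] -/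
theorem exists_relContent_eq_and_humbertInvariant_eq_iff {m Δ : ℤ} (hm : 0 < m) :
    (∃ q : Fin 5 → ℤ, relContent q = m ∧ humbertInvariant q = Δ) ↔
      m ^ 2 ∣ Δ ∧ (Δ / m ^ 2 % 4 = 0 ∨ Δ / m ^ 2 % 4 = 1) := by
  constructor
  · rintro ⟨q, hc, hΔ⟩
    have hq : q ≠ 0 := fun h ↦ by rw [h, (relContent_eq_zero_iff 0).2 rfl] at hc; omega
    obtain ⟨m', q₀, hm', rfl, hprim⟩ := exists_eq_smul_primitive hq
    rw [relContent_smul, IsPrimitiveRel.relContent_eq_one hprim, mul_one] at hc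
    rw [humbertInvariant_smul, ← sq_abs, hc] at hΔ
    refine ⟨⟨_, hΔ.symm⟩, ?_⟩
    rw [← hΔ, Int.mul_ediv_cancel_left _ (pow_ne_zero 2 hm.ne')]
    exact humbertInvariant_emod_four q₀
  · rintro ⟨hdvd, hmod⟩
    refine ⟨m • humbertNormalForm (Δ / m ^ 2 / 4) (Δ / m ^ 2 % 4), ?_, ?_⟩
    · rw [relContent_smul, (isPrimitiveRel_humbertNormalForm _ _).relContent_eq_one, mul_one, abs_of_pos hm]
    · rw [humbertInvariant_smul, humbertInvariant_humbertNormalForm, quadDisc_ediv_emod hmod]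
      exact Int.mul_ediv_cancel' hdvd

end Content

/-! ## §2 Rosati-invariant integer matrices `n·1 + R₀(q)` and their transport under `Sp₄(ℤ)` -/

section Rosati

/-- **Runge's Rosati-invariant integer matrices**: `X(n, q) := n·1₄ + R₀(q)`, `R₀(q) = humbertRatRep q` (row A4-59′; B–W's
rational representation (9) of the symmetric endomorphism `f₀` of the relation `q`) — "A Rosati invariant matrix is of
type `M = (A B; C ᵗA)`" with `A = (n a; −c n+b)`, `B = d(0 1; −1 0)`, `C = e(0 1; −1 0)` in the tree's letters.
[cite: Runge1999EndomorphismRingsAbelianSurfaces, §4 p. 288] [cite: BirkenhakeWilhelm2003, §4 Lemma 4.1 and eq. (9) (p. 1827)] -/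
def rosatiMatrix (n : ℤ) (q : Fin 5 → ℤ) : Matrix (Fin 2 ⊕ Fin 2) (Fin 2 ⊕ Fin 2) ℤ :=
  Matrix.diagonal (fun _ ↦ n) + humbertRatRep q

/-- `X(n, q) = n·1 + R₀(q)`. [cite: Runge1999EndomorphismRingsAbelianSurfaces, §4 p. 288] -/
theorem rosatiMatrix_eq_smul_one_add (n : ℤ) (q : Fin 5 → ℤ) :
    rosatiMatrix n q = n • (1 : Matrix (Fin 2 ⊕ Fin 2) (Fin 2 ⊕ Fin 2) ℤ) + humbertRatRep q := by
  rw [rosatiMatrix, Matrix.smul_one_eq_diagonal]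

/-- `tr X(n, q) = 4n + 2b` (Runge's reduced trace `t(M) = Tr(A) = 2n + b`, doubled). [cite: Runge1999EndomorphismRingsAbelianSurfaces, §4 p. 288] -/
theorem trace_rosatiMatrix (n : ℤ) (q : Fin 5 → ℤ) : (rosatiMatrix n q).trace = 4 * n + 2 * q 1 := by
  simp [rosatiMatrix, humbertRatRep, Matrix.trace, Matrix.diagonal, Fintype.sum_sum_type, Fin.sum_univ_two]
  ring

/-- The parameters are determined by the matrix: `X(n, q) = X(n′, q′) ⟹ n = n′ ∧ q = q′`. [cite: Runge1999EndomorphismRingsAbelianSurfaces, §4 p. 288] -/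
theorem rosatiMatrix_injective {n n' : ℤ} {q q' : Fin 5 → ℤ} (h : rosatiMatrix n q = rosatiMatrix n' q') :
    n = n' ∧ q = q' := by
  have e : ∀ i j, rosatiMatrix n q i j = rosatiMatrix n' q' i j := fun i j ↦ by rw [h]
  have h00 := e (inl 0) (inl 0)
  have h01 := e (inl 0) (inl 1)
  have h10 := e (inl 1) (inl 0)
  have h11 := e (inl 1) (inl 1)
  have h03 := e (inl 0) (inr 1)
  have h30 := e (inr 0) (inl 1)
  simp [rosatiMatrix, humbertRatRep, Matrix.diagonal] at h00 h01 h10 h11 h03 h30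
  refine ⟨h00, funext fun i ↦ ?_⟩
  fin_cases i
  · simpa using h01
  · simpa [h00] using h11
  · simpa using h10
  · simpa using h03
  · simpa using h30

/-- `R₀` is additive. [cite: BirkenhakeWilhelm2003, §4 eq. (9) (p. 1827)] -/
theorem humbertRatRep_add (q q' : Fin 5 → ℤ) : humbertRatRep (q + q') = humbertRatRep q + humbertRatRep q' := by
  rw [← neg_typeForm_mul_humbertGram, ← neg_typeForm_mul_humbertGram, ← neg_typeForm_mul_humbertGram, humbertGram_add,
    Matrix.mul_add]

/-- **B–W's (7) on the rational representation: `(−E₁ ᵗM E₁) R₀(q) M = R₀(q^M) + t·1`**, `t = (ᵗM N(q) M)_{x₁y₁}`, for EVERY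
integer `M` (for `M ∈ Sp₄(ℤ)` the left factor is `M⁻¹ = spInv M`, FILE 1) — the transport of a relation (row A4-59″
`q^M = q(ᵗM N(q) M)`) is CONJUGATION of the rational representation `R₀ = E₁⁻¹N` up to the scalar recording the lost
`E₁`-component (FILE 1 `eq_humbertGram_add_smul_typeForm`); "`ρ_{r,M(Z)} = ᵗM⁻¹ ρ_{r,Z} ᵗM`".
[cite: BirkenhakeWilhelm2003, §4 eq. (7) (p. 1827)] [cite: Runge1999EndomorphismRingsAbelianSurfaces, §4 Thm. 2 (p. 288)] -/
theorem spInv_mul_humbertRatRep_mul (M : Matrix (Fin 2 ⊕ Fin 2) (Fin 2 ⊕ Fin 2) ℤ) (q : Fin 5 → ℤ) :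
    spInv M * humbertRatRep q * M =
      humbertRatRep (humbertVectorConj M q) + (Mᵀ * humbertGram q * M) (inl 0) (inr 0) • 1 := by
  -- `X := ᵗM N M = N(q^M) + t E₁` and `ᵗM E₁ = E₁ M⁻¹`
  set X := Mᵀ * humbertGram q * M with hX
  have hXt : Xᵀ = -X := by
    rw [hX, transpose_mul, transpose_mul, transpose_transpose, humbertGram_transpose, Matrix.neg_mul,
      Matrix.mul_neg, Matrix.mul_assoc]
  have hdec := eq_humbertGram_add_smul_typeForm hXt
  have hconj : humbertVectorOfGram X = humbertVectorConj M q := rfl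
  rw [hconj] at hdec
  -- multiply the decomposition by `−E₁` on the left
  have hE : -(typeForm (fun _ : Fin 2 ↦ 1)) * X =
      humbertRatRep (humbertVectorConj M q) + X (inl 0) (inr 0) • 1 := by
    conv_lhs => rw [hdec]
    rw [Matrix.mul_add, neg_typeForm_mul_humbertGram, Matrix.mul_smul, Matrix.neg_mul, typeForm_one_mul_self, neg_neg]
  rw [← hE, hX]
  -- `−E₁ ᵗM N M = −E₁ ᵗM E₁ R₀ M = (−E₁ ᵗM E₁) R₀ M = M⁻¹ R₀ M`
  rw [← typeForm_mul_humbertRatRep q, spInv]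
  simp only [Matrix.neg_mul, Matrix.mul_assoc]

/-- **Transport of Rosati matrices: `M⁻¹ X(n, q) M = X(n + t, q^M)`.** [cite: Runge1999EndomorphismRingsAbelianSurfaces, §4 Thm. 2 (p. 288)] [cite: BirkenhakeWilhelm2003, §4 eq. (7) (p. 1827)] -/
theorem spInv_mul_rosatiMatrix_mul {M : Matrix (Fin 2 ⊕ Fin 2) (Fin 2 ⊕ Fin 2) ℤ}
    (hM : Mᵀ * typeForm (fun _ : Fin 2 ↦ 1) * M = typeForm fun _ : Fin 2 ↦ 1) (n : ℤ) (q : Fin 5 → ℤ) :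
    spInv M * rosatiMatrix n q * M =
      rosatiMatrix (n + (Mᵀ * humbertGram q * M) (inl 0) (inr 0)) (humbertVectorConj M q) := by
  rw [rosatiMatrix_eq_smul_one_add, rosatiMatrix_eq_smul_one_add, Matrix.mul_add, Matrix.add_mul,
    spInv_mul_humbertRatRep_mul M, Matrix.mul_smul, Matrix.mul_one, Matrix.smul_mul, spInv_mul hM, add_smul]
  abel

end Rosati

/-! ## §3 Runge's Theorem 2 -/

section Runge

/-- **`X(n, q)` and `X(n′, q′)` are `Sp₄(ℤ)`-conjugate iff they have the same trace and `q ∼ q′`** (FILE 1 `HumbertEquiv`).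
(⟸) `M⁻¹X(n,q)M = X(n + t, q^M)` and the traces force `n′ = n + t`; (⟹) `X(n′, q′) = X(n + t, q^M)` determines `q′ = q^M`.
[cite: Runge1999EndomorphismRingsAbelianSurfaces, §4 Thm. 2 (p. 288)] -/
theorem exists_conj_rosatiMatrix_iff (n n' : ℤ) (q q' : Fin 5 → ℤ) :
    (∃ M : Matrix (Fin 2 ⊕ Fin 2) (Fin 2 ⊕ Fin 2) ℤ, Mᵀ * typeForm (fun _ : Fin 2 ↦ 1) * M = typeForm (fun _ : Fin 2 ↦ 1) ∧
        spInv M * rosatiMatrix n q * M = rosatiMatrix n' q') ↔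
      (rosatiMatrix n q).trace = (rosatiMatrix n' q').trace ∧ HumbertEquiv q q' := by
  constructor
  · rintro ⟨M, hM, h⟩
    have htr : (rosatiMatrix n q).trace = (rosatiMatrix n' q').trace := by
      rw [← h, Matrix.trace_mul_cycle, mul_spInv hM, Matrix.one_mul]
    rw [spInv_mul_rosatiMatrix_mul hM] at h
    exact ⟨htr, M, hM, (rosatiMatrix_injective h).2⟩
  · rintro ⟨htr, M, hM, hq⟩
    refine ⟨M, hM, ?_⟩
    have hcyc : (spInv M * rosatiMatrix n q * M).trace = (rosatiMatrix n q).trace := by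
      rw [Matrix.trace_mul_cycle, mul_spInv hM, Matrix.one_mul]
    rw [spInv_mul_rosatiMatrix_mul hM, hq] at hcyc ⊢
    simp only [trace_rosatiMatrix] at hcyc htr
    congr 1
    omega

/-- **RUNGE'S THEOREM 2 (Tohoku Math. J. 51, p. 288), AS PRINTED on relation parameters: "Let `M₁`, `M₂` be Rosati
invariant elements in `M₄(ℤ)`. Then there exists an element `σ ∈ Γ₂` such that `σM₁σ⁻¹ = M₂` if and only if
`t(M₁) = t(M₂)`, `g.c.d(M₁) = g.c.d(M₂)` and `Δ(M₁) = Δ(M₂)`"** — here `Mᵢ = X(nᵢ, qᵢ) = nᵢ·1 + R₀(qᵢ)`, `σ = M⁻¹` for an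
integral symplectic `M`, `t ↔ trace`, `g.c.d ↔ relContent qᵢ` (content of the relation part), `Δ ↔ humbertInvariant qᵢ`.
[cite: Runge1999EndomorphismRingsAbelianSurfaces, §4 Thm. 2 (p. 288)] -/
theorem runge_theorem_two (n n' : ℤ) (q q' : Fin 5 → ℤ) :
    (∃ M : Matrix (Fin 2 ⊕ Fin 2) (Fin 2 ⊕ Fin 2) ℤ, Mᵀ * typeForm (fun _ : Fin 2 ↦ 1) * M = typeForm (fun _ : Fin 2 ↦ 1) ∧
        spInv M * rosatiMatrix n q * M = rosatiMatrix n' q') ↔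
      (rosatiMatrix n q).trace = (rosatiMatrix n' q').trace ∧ relContent q = relContent q' ∧
        humbertInvariant q = humbertInvariant q' := by
  rw [exists_conj_rosatiMatrix_iff, humbertEquiv_iff_relContent_eq_and_humbertInvariant_eq]

/-- **Runge's normal form for primitive Rosati matrices: `X(n, q)` with `q` primitive is `Sp₄(ℤ)`-conjugate to some
`X(n′, (k, l, −1, 0, 0))` with `l ∈ {0, 1}`** ("we finally obtain a normal form for primitive normalized matrices …
`Δ(M) = 4k + l` with `k ∈ ℤ` and `l ∈ {0, 1}`"). [cite: Runge1999EndomorphismRingsAbelianSurfaces, §4 p. 290] -/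
theorem exists_conj_rosatiMatrix_humbertNormalForm (n : ℤ) {q : Fin 5 → ℤ} (hq : IsPrimitiveRel q) :
    ∃ (k l n' : ℤ) (M : Matrix (Fin 2 ⊕ Fin 2) (Fin 2 ⊕ Fin 2) ℤ), (l = 0 ∨ l = 1) ∧
      Mᵀ * typeForm (fun _ : Fin 2 ↦ 1) * M = typeForm (fun _ : Fin 2 ↦ 1) ∧
      spInv M * rosatiMatrix n q * M = rosatiMatrix n' (humbertNormalForm k l) := by
  obtain ⟨k, l, hl, M, hM, hqM⟩ := exists_humbertEquiv_humbertNormalForm hq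
  exact ⟨k, l, _, M, hl, hM, by rw [spInv_mul_rosatiMatrix_mul hM, hqM]⟩

end Runge

/-! ## §4 Humbert's singular abelian surfaces: the Noether–Lefschetz locus `𝒩(𝔥₂)` is the union of the orbits `Sp₄(ℤ) · π_{k,l}(ℍ²)` -/

section Singular

/-- **`𝒩(𝔥₂) = ⋃_Δ N_Δ`**: the Hodge-exceptional locus of the Siegel family of principally polarised abelian surfaces
(row A4-56: `Z` with a Hodge class off `ℚ·E_Z`, i.e. `ρ(X_Z) ≥ 2`) is the union of Hashimoto–Murabayashi's `N_Δ` over all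
`Δ` (row A4-59″ `hodgeExceptionalLocus_two_eq_iUnion_humbertLocusOfInvariant` with FILE 2's
`H_Δ(𝔥₂) = ⋃_{m² ∣ Δ} N_{Δ/m²}`). [cite: BirkenhakeWilhelm2003, §1 (∗) (p. 1819)] [cite: HashimotoMurabayashi1995, Def. 3.6] -/
theorem hodgeExceptionalLocus_two_eq_iUnion_humbertLocusPrim :
    hodgeExceptionalLocus 2 = ⋃ Δ : ℤ, humbertLocusPrim Δ := by
  rw [hodgeExceptionalLocus_two_eq_iUnion_humbertLocusOfInvariant]
  apply Set.Subset.antisymm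
  · intro Z hZ
    simp only [Set.mem_iUnion, exists_prop] at hZ
    obtain ⟨Δ, -, hZ⟩ := hZ
    rw [humbertLocusOfInvariant_eq_iUnion_humbertLocusPrim] at hZ
    simp only [Set.mem_iUnion, exists_prop] at hZ
    obtain ⟨m, -, hZ⟩ := hZ
    exact Set.mem_iUnion.2 ⟨_, hZ⟩
  · intro Z hZ
    obtain ⟨Δ, hZ⟩ := Set.mem_iUnion.1 hZ
    have hpos : 0 < Δ := ((humbertLocusPrim_nonempty_iff Δ).1 ⟨Z, hZ⟩).1
    simp only [Set.mem_iUnion, exists_prop]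
    exact ⟨Δ, hpos, humbertLocusPrim_subset_humbertLocusOfInvariant Δ hZ⟩

/-- **HUMBERT'S SINGULAR ABELIAN SURFACES: a principally polarised abelian surface `X_Z` carries a Hodge class off
`ℚ·θ_Z` (`ρ(X_Z) ≥ 2`, `Z ∈ 𝒩(𝔥₂)`) iff `Z = γ · π_{k,l}(τ)` for some `γ ∈ Sp₄(ℤ)`, some order parameters `(k, l)` with
`l² + 4k > 0` and some `τ ∈ ℍ × ℍ`** — i.e. iff `X_Z` is `Sp₄(ℤ)`-equivalent to a member of Runge's standard model of some
Humbert surface (real multiplication by an order `O_Δ`, row A4-64 FILE 2, or the split case `Δ = f²`).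
[cite: Runge1999EndomorphismRingsAbelianSurfaces, §4 pp. 290–291] [cite: HashimotoMurabayashi1995, Prop. 2.7] [cite: BirkenhakeWilhelm2003, §4 Prop. 4.7 and Prop. 4.9 (pp. 1830–1831)] -/
theorem mem_hodgeExceptionalLocus_two_iff_exists_smul_modularEmbedding (Z : siegelUpperHalfSpace 2) :
    Z ∈ hodgeExceptionalLocus 2 ↔
      ∃ (k l : ℤ) (hΔ : 0 < quadDisc k l) (M : symplecticLatticeGroup (fun _ : Fin 2 ↦ 1)) (τ : Fin 2 → ℍ),
        Z = gDHom (fun _ : Fin 2 ↦ 1) principalType_pos M • modularEmbedding k l hΔ τ := by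
  rw [hodgeExceptionalLocus_two_eq_iUnion_humbertLocusPrim, Set.mem_iUnion]
  constructor
  · rintro ⟨Δ, hZ⟩
    obtain ⟨hpos, hmod⟩ := (humbertLocusPrim_nonempty_iff Δ).1 ⟨Z, hZ⟩
    have hΔ : 0 < quadDisc (Δ / 4) (Δ % 4) := by rwa [quadDisc_ediv_emod hmod]
    rw [← quadDisc_ediv_emod hmod] at hZ
    obtain ⟨M, τ, rfl⟩ := (mem_humbertLocusPrim_iff_exists_smul_modularEmbedding hΔ _).1 hZ
    exact ⟨_, _, hΔ, M, τ, rfl⟩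
  · rintro ⟨k, l, hΔ, M, τ, rfl⟩
    exact ⟨quadDisc k l, (mem_humbertLocusPrim_iff_exists_smul_modularEmbedding hΔ _).2 ⟨M, τ, rfl⟩⟩

end Singular

end SiegelModuli

end Literature.AlgebraicGeometry.ModuliOfAbelianVarieties

end
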